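import Mathlib
import Summits.ValiantsHypothesis.ValiantsHypothesis.Theorems.GrenetZeonTwoDimCoefficientsGradedHessianRate
import Summits.ValiantsHypothesis.ValiantsHypothesis.Theorems.GrenetZeonTwoDimCoefficientsScalingBlockTriangularCoupling

/-!
# Crux `GrenetZeon.TwoDimCoefficients` (stmt-ValiantsHypothesis-8062) / rung `DualUnipotentThreeHalves` (stmt-24318):
# the MASS CUT in Hessian currency with a THIRD priced constituent type — consecutive-graded parts of ANY nil-index

The census's mass cut in Hessian currency (✓ `sq_sub_mul_le_of_tracePowParts_add_rankPart`, memo NINETEENTH-HAND §10) prices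
two constituent types: index-`n` parts (per-free rate `2m²/n`, ✓ `rank_hess0_top_mul_le_of_index`) and a rest `g` by its Hessian
rank at one permutation point (support garbage: `2|S|`).  Theorem T7 (✓ `rank_hess0_graded_mul_le`, memo TWENTY-SECOND HAND)
adds a third type: CONSECUTIVE-GRADED parts `tr(G_k^{n−1}·M'_k)` of ANY nil-index, priced `12·m'_k²/⌊n/4⌋` each.  Ranks add, so

  `per_n = Σ_i κ_i·tr(N_i^{n−1}·M_i) + Σ_k tr(G_k^{n−1}·M'_k) + g`,  `N_iⁿ = 0`, `G_k` consecutive-graded, `rank Hess_{P_τ} g ≤ ρ`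
  ⟹ `(n² − ρ − Σ_k ⌊12·m'_k²/⌊n/4⌋⌋)·n ≤ 2·Σ_i m_i²`   (`n ≥ 4`).

* ★★ `sq_sub_mul_le_of_indexParts_gradedParts_rankPart` — the inequality above;
* `rank_hess0_graded_le_div` — T7 in quotient form, including the degenerate sizes `m' ≤ n − 1` (where the part vanishes).

HONEST FRAMING: unconditional for DECOMPOSED representations of the stated shape (direct sums; the user supplies the split);
block-triangular coupling between the parts, diagonal classes inside a graded part, and wild constituents are NOT covered; the stub
`DualUnipotentBound`, crux 8062, the 24318 decl in general and `VP ≠ VNP` remain open.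

References: T. Mignon, N. Ressayre, Int. Math. Res. Not. 2004:79, Thm. 1.1 (via the tree); folklore.
-/

set_option linter.dupNamespace false
set_option autoImplicit false

noncomputable section

namespace Summit.ValiantsHypothesis.ValiantsHypothesis.Theorems.GrenetZeonTwoDimCoefficients.GradedMassCut

open Module Matrix MvPolynomial
open Literature.Computability.AlgebraicComplexity
open Summit.ValiantsHypothesis.ValiantsHypothesis.Cruxes.TwoDimCoefficients.DimTwoCases (AffMat IsAffine)
open Summit.ValiantsHypothesis.ValiantsHypothesis.Theorems.GrenetZeonTwoDimCoefficients.GradedTopTrace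
  (pow_eq_zero_of_graded)
open Summit.ValiantsHypothesis.ValiantsHypothesis.Theorems.GrenetZeonTwoDimCoefficients.GradedHessianRate
  (rank_hess0_graded_mul_le)
open Summit.ValiantsHypothesis.ValiantsHypothesis.Theorems.GrenetZeonTwoDimCoefficients.ScalingClosure
  (sq_sub_mul_le_of_tracePowParts_add_rankPart)

variable {n : ℕ}

/-- **T7 in quotient form, all sizes.**  For `G` linear consecutive-graded of size `m'`, `M'` linear, `n ≥ 4`, every point `z`:
`rank Hess_z tr(G^{n−1}·M') ≤ ⌊12·m'²/⌊n/4⌋⌋` (for `m' ≤ n − 1` the part vanishes). [folklore] -/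
theorem rank_hess0_graded_le_div (hn : 4 ≤ n) {m' : ℕ} (lvl : Fin m' → ℕ) (G M' : AffMat n m')
    (hG : ∀ a b, (G a b).IsHomogeneous 1) (hM' : ∀ a b, (M' a b).IsHomogeneous 1)
    (hgr : ∀ a b, lvl b ≠ lvl a + 1 → G a b = 0) (z : Fin n × Fin n → ℂ) :
    (hess0 (transl z ((G ^ (n - 1) * M').trace))).rank ≤ 12 * m' ^ 2 / (n / 4) := by
  classical
  by_cases hm : n - 1 < m'
  · rw [Nat.le_div_iff_mul_le (by omega)]
    exact rank_hess0_graded_mul_le lvl G M' (fun a b => (hG a b).totalDegree_le) (fun a b => (hM' a b).totalDegree_le)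
      hgr hn hm z
  · -- the part vanishes: `G^{m'} = 0` and `m' ≤ n − 1`
    have hG0 : G ^ (n - 1) = 0 := by
      obtain ⟨d, hd⟩ := Nat.exists_eq_add_of_le (not_lt.mp hm)
      rw [hd, pow_add, pow_eq_zero_of_graded lvl G hgr, Matrix.zero_mul]
    rw [hG0, Matrix.zero_mul, Matrix.trace_zero, map_zero, map_zero, Matrix.rank_zero]
    exact Nat.zero_le _

/-- ★★ **Mass cut with three priced constituent types.**  If
`per_n = Σ_i κ_i·tr(N_i^{n−1}·M_i) + (Σ_k tr(G_k^{n−1}·M'_k) + g)` with `N_i, M_i` linear of size `m_i`, `N_iⁿ = 0`, `N_i^{m_i} = 0`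
(index-`n` parts), `G_k, M'_k` linear of size `m'_k` with `G_k` consecutive-graded for some `lvl_k` (graded parts of ANY nil-index), and
`rank Hess g(P_τ) ≤ ρ` at a permutation point, then `(n² − (ρ + Σ_k ⌊12·m'_k²/⌊n/4⌋⌋))·n ≤ 2·Σ_i m_i²` (`n ≥ 4`).
[cite: MignonRessayre2004, Thm. 1.1 — via the tree; folklore] -/
theorem sq_sub_mul_le_of_indexParts_gradedParts_rankPart {r r' : ℕ} (hn : 4 ≤ n) (m : Fin r → ℕ)
    (N M : ∀ i : Fin r, AffMat n (m i)) (κ : Fin r → ℂ)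
    (hN : ∀ i a b, (N i a b).IsHomogeneous 1) (hM : ∀ i a b, (M i a b).IsHomogeneous 1) (hNn : ∀ i, N i ^ n = 0)
    (hNm : ∀ i, N i ^ (m i) = 0)
    (m' : Fin r' → ℕ) (lvl : ∀ k : Fin r', Fin (m' k) → ℕ) (G M' : ∀ k : Fin r', AffMat n (m' k))
    (hG : ∀ k a b, (G k a b).IsHomogeneous 1) (hM' : ∀ k a b, (M' k a b).IsHomogeneous 1)
    (hgr : ∀ k a b, lvl k b ≠ lvl k a + 1 → G k a b = 0)
    (g : MvPolynomial (Fin n × Fin n) ℂ) (τ : Equiv.Perm (Fin n)) (ρ : ℕ)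
    (hg : (hess0 (transl (fun u : Fin n × Fin n => if u.1 = τ u.2 then (1 : ℂ) else 0) g)).rank ≤ ρ)
    (hper : perPoly (Fin n) ℂ = (∑ i, MvPolynomial.C (κ i) * (N i ^ (n - 1) * M i).trace) +
      ((∑ k, (G k ^ (n - 1) * M' k).trace) + g)) :
    (n ^ 2 - (ρ + ∑ k, 12 * m' k ^ 2 / (n / 4))) * n ≤ 2 * ∑ i, m i ^ 2 := by
  classical
  set z : Fin n × Fin n → ℂ := fun u => if u.1 = τ u.2 then (1 : ℂ) else 0 with hz
  -- the rest `g' = Σ_k tr(G_k^{n−1} M'_k) + g` is priced by rank additivity and T7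
  have hg' : (hess0 (transl z ((∑ k, (G k ^ (n - 1) * M' k).trace) + g))).rank ≤ ρ + ∑ k, 12 * m' k ^ 2 / (n / 4) := by
    rw [map_add, map_add, map_sum, map_sum]
    refine (rank_add_le _ _).trans ?_
    rw [add_comm]
    refine Nat.add_le_add hg ((Literature.Computability.AlgebraicComplexity.rank_sum_le _ _).trans (Finset.sum_le_sum fun k _ => ?_))
    exact rank_hess0_graded_le_div hn (lvl k) (G k) (M' k) (hG k) (hM' k) (hgr k) z
  exact sq_sub_mul_le_of_tracePowParts_add_rankPart (by omega) m N M κ hN hM hNn hNm _ τ _ hg' hper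

end Summit.ValiantsHypothesis.ValiantsHypothesis.Theorems.GrenetZeonTwoDimCoefficients.GradedMassCut

end
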